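import Literature.Topology.FourManifolds.BoundarySliceCharts
import Literature.Topology.FourManifolds.RegularLevelMorseData
import Literature.Topology.FourManifolds.MorseChartChangeInterior
import HarnessLib

/-!
# Morse data of a function restricted to a half-slice subset, read in an ambient chart

Topic `Literature/Topology/FourManifolds`; infrastructure for the fact seat
`provefact-Literature.Topology.FourManifolds.exists_isBalancedGKTrisection` (Gay–Kirby 2016,
Thm. 4 via §4, Lemma 14).  Everything in this file is **proved**; no definitions, no named
facts.

The handlebody `H₂₃ = X₂ ∩ X₃` of the trisection construction is a subset of the closed
`4`-manifold `X` carrying the manifold-with-boundary structure of a **boundary slice atlas**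
(`Literature.Topology.FourManifolds.BoundarySliceAtlas`, `BoundarySliceCharts.lean`, Lee 2013,
Thm. 5.51: in the chart `Θ` of `X` the subset is `{y_{k+1} = 0, 0 ≤ y₀}`), and its Morse
function is the restriction of an explicit smooth function `F` on `X`.  This file is the
dictionary reading the Morse data of `F|S` at **interior** points of such a subset `S` off the
ambient formulas, in an **arbitrary** chart `e` of the maximal atlas of the ambient manifold —
the companion, for half-slice subsets, of `RegularLevelMorseData.lean` (regular levels):

* `BoundarySliceAtlas.chart_mem_maximalAtlas` — the chart of `S` induced by *any* boundary
  slice chart `D` of `S` lies in the maximal atlas of the structure;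
* `BoundarySliceAtlas.apply_zero_pos_of_isInteriorPoint` — at an interior point every boundary
  slice chart has positive `0`-th coordinate (interior points are chart-independent);
* `BoundarySliceAtlas.comp_val_comp_extend_symm_eventuallyEq` — near an interior point, `F|S`
  written in the chart induced by `D` is `(F ∘ Θ⁻¹) ∘ sliceInl`;
* `BoundarySliceAtlas.range_fderiv_extendCoordChange_comp_sliceInl` — the derivative `T` of
  the change of coordinates `e ∘ Θ⁻¹` maps the slice hyperplane onto
  `V = ker D(g ∘ e⁻¹)(e p)`, `g = Θ_{k+1}` the slice-defining coordinate (Lee 2013,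
  Prop. 5.38);
* `BoundarySliceAtlas.isMCriticalPt_comp_val_iff_of_chart` — **`p` is critical for `F|S` iff
  `D(F ∘ e⁻¹)(e p)` vanishes on `V`** (Lagrange's condition);
* `BoundarySliceAtlas.exists_linearEquiv_mhessian_comp_val_eq`,
  `nondegenerate_mhessian_comp_val_iff`, `morseIndex_comp_val_eq` — **at an ambient critical
  point of `F`, the Hessian of `F|S` is congruent to `D²(F ∘ e⁻¹)(e p)|_V`**, so nondegeneracy
  and the Morse index of `F|S` are those of the restricted form (Milnor 1963, §2; Sylvester).

## References

* J. Milnor, *Morse theory* (1963), §2. [Milnor1963]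
* J. M. Lee, *Introduction to Smooth Manifolds* (2013), Thm. 5.51 (boundary slice charts),
  Prop. 5.38 (tangent space of a level). [LeeSmoothManifolds2013]
* D. Gay, R. Kirby, *Trisecting 4-manifolds*, Geom. Topol. 20 (2016), §4, Lemma 14.
  [GayKirby2016]
-/

open scoped Manifold ContDiff Topology
open Set Function Filter

noncomputable section

universe u

namespace Literature.Topology.FourManifolds

namespace BoundarySliceAtlas

variable {k : ℕ} {M : Type u} [TopologicalSpace M] [ChartedSpace (EuclideanSpace ℝ (Fin (k + 2))) M]
  [IsManifold (𝓡 (k + 2)) ∞ M] {S : Set M} (Φ : BoundarySliceAtlas k S)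

/-! ### Charts induced by arbitrary boundary slice charts -/

omit [IsManifold (𝓡 (k + 2)) ∞ M] in
/-- **The chart of `S` induced by any boundary slice chart lies in the maximal atlas** of the
structure `Φ.chartedSpace` (it is a member of its atlas). [cite: LeeSmoothManifolds2013, Thm. 5.51] -/
theorem chart_mem_maximalAtlas (D : BoundarySliceChart k S) (p : S) :
    letI := Φ.chartedSpace
    D.chart p ∈ IsManifold.maximalAtlas (𝓡∂ (k + 1)) ∞ S := by
  letI := Φ.chartedSpace
  haveI := Φ.isManifold
  exact IsManifold.subset_maximalAtlas (Φ.chart_mem_atlas D p)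

omit [IsManifold (𝓡 (k + 2)) ∞ M] in
/-- **At an interior point every boundary slice chart has positive `0`-th coordinate**
(interior points are chart-independent: a chart of the maximal atlas maps an interior point
into the interior of the half-space, `mem_interior_range_extend_of_mem_maximalAtlas`). [cite: LeeSmoothManifolds2013, Thm. 5.51] -/
theorem apply_zero_pos_of_isInteriorPoint (D : BoundarySliceChart k S) {p : S}
    (hp : p.1 ∈ D.Θ.source) (hint : letI := Φ.chartedSpace; (𝓡∂ (k + 1)).IsInteriorPoint p) :
    0 < D.Θ p.1 0 := by
  letI := Φ.chartedSpace
  haveI := Φ.isManifold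
  have h := mem_interior_range_extend_of_mem_maximalAtlas (I := 𝓡∂ (k + 1)) (n := ∞) (by simp)
    (Φ.chart_mem_maximalAtlas D p) (show p ∈ (D.chart p).source from hp) hint
  rw [D.extend_chart_apply (p := p) (q := p) hp, interior_range_modelWithCornersEuclideanHalfSpace] at h
  have h' : 0 < dropLast k (D.Θ p.1) 0 := h
  rwa [dropLast_apply_zero] at h'

omit [IsManifold (𝓡 (k + 2)) ∞ M] in
/-- **`F|S` written in the chart induced by a boundary slice chart**: near an interior point
`p` of `S`, `(F ∘ ι) ∘ κ⁻¹ = (F ∘ Θ⁻¹) ∘ sliceInl`, `κ` the chart of `S` induced by `D`,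
`Θ = D.Θ`, `sliceInl u = (u, 0)`. [cite: LeeSmoothManifolds2013, Thm. 5.51] -/
theorem comp_val_comp_extend_symm_eventuallyEq (F : M → ℝ) (D : BoundarySliceChart k S) {p : S}
    (hp : p.1 ∈ D.Θ.source) (hint : letI := Φ.chartedSpace; (𝓡∂ (k + 1)).IsInteriorPoint p) :
    ((F ∘ Subtype.val) ∘ ((D.chart p).extend (𝓡∂ (k + 1))).symm) =ᶠ[𝓝 ((D.chart p).extend (𝓡∂ (k + 1)) p)]
      (F ∘ D.Θ.symm) ∘ sliceInl (k + 1) := by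
  have h0 := Φ.apply_zero_pos_of_isInteriorPoint D hp hint
  set N : Set (EuclideanSpace ℝ (Fin (k + 1))) :=
    {z | 0 < z 0 ∧ snocEquiv (k + 1) (z, 0) ∈ D.Θ.target} with hN
  have hNo : IsOpen N := by
    refine IsOpen.inter (isOpen_lt continuous_const (PiLp.continuous_apply 2 _ 0)) ?_
    exact D.Θ.open_target.preimage (contDiff_snocEquiv_zero (k + 1)).continuous
  have hmem : (D.chart p).extend (𝓡∂ (k + 1)) p ∈ N := by
    rw [D.extend_chart_apply (p := p) (q := p) hp]
    refine ⟨by rwa [dropLast_apply_zero], ?_⟩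
    rw [D.snocEquiv_dropLast_apply hp p.2]
    exact D.Θ.map_source hp
  filter_upwards [hNo.mem_nhds hmem] with z hz
  simp only [comp_apply, sliceInl_apply]
  rw [D.coe_extend_chart_symm_of_mem hz.1.le hz.2]

/-! ### The slice-defining coordinate and the tangent hyperplane -/

omit [IsManifold (𝓡 (k + 2)) ∞ M] in
/-- The slice-defining coordinate `g = Θ_{k+1}` read in `Θ` is the last coordinate:
`D(g ∘ Θ⁻¹)(Θ p) v = v_{k+1}`. [folklore] -/
theorem fderiv_sliceFun_comp_symm_apply (D : BoundarySliceChart k S) {p : S} (hp : p.1 ∈ D.Θ.source)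
    (v : EuclideanSpace ℝ (Fin (k + 2))) :
    fderiv ℝ ((fun q => D.Θ q (Fin.last (k + 1))) ∘ D.Θ.symm) (D.Θ p.1) v = v (Fin.last (k + 1)) := by
  have hev : ((fun q => D.Θ q (Fin.last (k + 1))) ∘ D.Θ.symm) =ᶠ[𝓝 (D.Θ p.1)]
      fun z => z (Fin.last (k + 1)) := by
    filter_upwards [D.Θ.open_target.mem_nhds (D.Θ.map_source hp)] with z hz
    simp only [comp_apply, D.Θ.right_inv hz]
  rw [hev.fderiv_eq]
  have h := (EuclideanSpace.proj (𝕜 := ℝ) (Fin.last (k + 1)) :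
    EuclideanSpace ℝ (Fin (k + 2)) →L[ℝ] ℝ).fderiv (x := D.Θ p.1)
  have hfun : (fun z : EuclideanSpace ℝ (Fin (k + 2)) => z (Fin.last (k + 1))) =
      ⇑(EuclideanSpace.proj (𝕜 := ℝ) (Fin.last (k + 1)) : EuclideanSpace ℝ (Fin (k + 2)) →L[ℝ] ℝ) := by
    funext z; rfl
  rw [hfun, h]
  rfl

variable {Φ}

/-- **The tangent hyperplane of the half-slice subset in a chart.**  For an interior point `p`
of `S`, a boundary slice chart `D` at `p` and a chart `e` of the maximal atlas of `M` at `p`,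
the derivative `T` of the change of coordinates `e ∘ Θ⁻¹` maps the slice hyperplane
`sliceInl(ℝᵏ⁺¹)` onto `V = ker D(g ∘ e⁻¹)(e p)`, `g = Θ_{k+1}` (Lee 2013, Prop. 5.38).
[cite: LeeSmoothManifolds2013, Prop. 5.38] -/
theorem range_fderiv_extendCoordChange_comp_sliceInl (D : BoundarySliceChart k S) {p : S}
    (hp : p.1 ∈ D.Θ.source) {e : OpenPartialHomeomorph M (EuclideanSpace ℝ (Fin (k + 2)))}
    (he : e ∈ IsManifold.maximalAtlas (𝓡 (k + 2)) ∞ M) (hpe : p.1 ∈ e.source) :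
    LinearMap.range (((fderiv ℝ ((𝓡 (k + 2)).extendCoordChange D.Θ e) (D.Θ p.1)).comp
        (sliceInl (k + 1)) : EuclideanSpace ℝ (Fin (k + 1)) →L[ℝ] EuclideanSpace ℝ (Fin (k + 2))) :
          EuclideanSpace ℝ (Fin (k + 1)) →ₗ[ℝ] EuclideanSpace ℝ (Fin (k + 2))) =
      LinearMap.ker (fderiv ℝ ((fun q => D.Θ q (Fin.last (k + 1))) ∘ e.symm) (e p.1) :
        EuclideanSpace ℝ (Fin (k + 2)) →ₗ[ℝ] ℝ) := by
  set g : M → ℝ := fun q => D.Θ q (Fin.last (k + 1)) with hg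
  have hΘ2 : D.Θ ∈ IsManifold.maximalAtlas (𝓡 (k + 2)) 2 M :=
    IsManifold.maximalAtlas_subset_of_le (by norm_cast) D.Θ_mem_maximalAtlas
  have he2 : e ∈ IsManifold.maximalAtlas (𝓡 (k + 2)) 2 M :=
    IsManifold.maximalAtlas_subset_of_le (by norm_cast) he
  set T := fderiv ℝ ((𝓡 (k + 2)).extendCoordChange D.Θ e) (D.Θ p.1) with hT
  -- `g` is smooth at `p`
  have hgs : ContMDiffAt (𝓡 (k + 2)) 𝓘(ℝ, ℝ) 2 g p.1 := by
    have h1 : ContMDiffAt (𝓡 (k + 2)) (𝓡 (k + 2)) ∞ D.Θ p.1 :=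
      D.contMDiffOn_toFun.contMDiffAt (D.Θ.open_source.mem_nhds hp)
    have h2 : ContMDiffAt (𝓡 (k + 2)) 𝓘(ℝ, EuclideanSpace ℝ (Fin (k + 2))) ∞ D.Θ p.1 :=
      contMDiffAt_iff_target.2 ⟨h1.continuousAt, by simpa using (contMDiffAt_iff_target.1 h1).2⟩
    have h3 := ((EuclideanSpace.proj (𝕜 := ℝ) (Fin.last (k + 1)) :
      EuclideanSpace ℝ (Fin (k + 2)) →L[ℝ] ℝ).contDiff.contMDiff.contMDiffAt).comp p.1 h2
    exact h3.of_le (by norm_cast)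
  -- `D(g ∘ Θ⁻¹)(Θ p) = D(g ∘ e⁻¹)(e p) ∘ T`
  have hev := RegularLevel.comp_symm_eventuallyEq_comp_extendCoordChange g hp hpe
  have hτ : ContDiffAt ℝ 2 ((𝓡 (k + 2)).extendCoordChange D.Θ e) (D.Θ p.1) :=
    RegularLevel.contDiffAt_extendCoordChange hΘ2 he2 hp hpe
  have hτp : (𝓡 (k + 2)).extendCoordChange D.Θ e (D.Θ p.1) = e p.1 := by
    simp [ModelWithCorners.extendCoordChange, D.Θ.left_inv hp]
  have hge : ContDiffAt ℝ 2 (g ∘ e.symm) (e p.1) := by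
    have := contDiffAt_comp_extend_symm hgs he2 hpe
    simpa [OpenPartialHomeomorph.extend_coe, OpenPartialHomeomorph.extend_coe_symm] using this
  have hchain : fderiv ℝ (g ∘ D.Θ.symm) (D.Θ p.1) = (fderiv ℝ (g ∘ e.symm) (e p.1)).comp T := by
    rw [hev.fderiv_eq, fderiv_comp _ (by rw [hτp]; exact hge.differentiableAt (by norm_num))
      (hτ.differentiableAt (by norm_num)), hτp]
  have hlast : ∀ v, (fderiv ℝ (g ∘ e.symm) (e p.1)) (T v) = v (Fin.last (k + 1)) := fun v => by
    have h := fderiv_sliceFun_comp_symm_apply D hp v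
    rw [show ((fun q => D.Θ q (Fin.last (k + 1))) ∘ D.Θ.symm) = g ∘ D.Θ.symm from rfl, hchain] at h
    exact h
  have hTinv := RegularLevel.isInvertible_fderiv_extendCoordChange hΘ2 he2 hp hpe
  apply le_antisymm
  · rintro _ ⟨u, rfl⟩
    rw [LinearMap.mem_ker]
    show (fderiv ℝ (g ∘ e.symm) (e p.1)) (T (sliceInl (k + 1) u)) = 0
    rw [hlast, sliceInl_apply_last]
  · intro v hv
    rw [LinearMap.mem_ker] at hv
    obtain ⟨w, rfl⟩ : ∃ w, T w = v := hTinv.surjective v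
    have hw : w (Fin.last (k + 1)) = 0 := by rw [← hlast w]; exact hv
    refine ⟨dropLast k w, ?_⟩
    show T (sliceInl (k + 1) (dropLast k w)) = T w
    rw [sliceInl_apply, snocEquiv_dropLast k hw]

/-! ### Critical points of `F|S`, read in any ambient chart -/

/-- **Critical points of `F` restricted to a half-slice subset, read in any chart.**  Let `p`
be an interior point of `S` (structure `Φ.chartedSpace`), `D` a boundary slice chart of `S` at
`p`, `F` of class `C²` at `p` and `e` a chart of the maximal atlas of `M` at `p`.  Then `p` is a
critical point of `F|S` iff `D(F ∘ e⁻¹)(e p)` vanishes on `V = ker D(g ∘ e⁻¹)(e p)`,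
`g = Θ_{k+1}` — the tangent space of `S` read in `e` (Lagrange's condition).
[cite: LeeSmoothManifolds2013, Prop. 5.38] [cite: Milnor1963, §2] -/
theorem isMCriticalPt_comp_val_iff_of_chart {F : M → ℝ} (D : BoundarySliceChart k S) {p : S}
    (hp : p.1 ∈ D.Θ.source) (hint : letI := Φ.chartedSpace; (𝓡∂ (k + 1)).IsInteriorPoint p)
    (hF : ContMDiffAt (𝓡 (k + 2)) 𝓘(ℝ, ℝ) 2 F p.1)
    {e : OpenPartialHomeomorph M (EuclideanSpace ℝ (Fin (k + 2)))}
    (he : e ∈ IsManifold.maximalAtlas (𝓡 (k + 2)) ∞ M) (hpe : p.1 ∈ e.source) :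
    letI := Φ.chartedSpace
    IsMCriticalPt (𝓡∂ (k + 1)) (F ∘ Subtype.val) p ↔
      ∀ v, fderiv ℝ ((fun q => D.Θ q (Fin.last (k + 1))) ∘ e.symm) (e p.1) v = 0 →
        fderiv ℝ (F ∘ e.symm) (e p.1) v = 0 := by
  letI := Φ.chartedSpace
  haveI := Φ.isManifold
  set κ := D.chart p with hκ
  have hκ2 : κ ∈ IsManifold.maximalAtlas (𝓡∂ (k + 1)) 2 S :=
    IsManifold.maximalAtlas_subset_of_le (by norm_cast) (Φ.chart_mem_maximalAtlas D p)
  have hΘ2 : D.Θ ∈ IsManifold.maximalAtlas (𝓡 (k + 2)) 2 M :=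
    IsManifold.maximalAtlas_subset_of_le (by norm_cast) D.Θ_mem_maximalAtlas
  have he2 : e ∈ IsManifold.maximalAtlas (𝓡 (k + 2)) 2 M :=
    IsManifold.maximalAtlas_subset_of_le (by norm_cast) he
  have hpκ : p ∈ κ.source := hp
  have hval : ContMDiff (𝓡∂ (k + 1)) (𝓡 (k + 2)) ∞ (Subtype.val : S → M) := Φ.contMDiff_subtype_val
  have hFv : ContMDiffAt (𝓡∂ (k + 1)) 𝓘(ℝ, ℝ) 2 (F ∘ Subtype.val) p :=
    hF.comp p ((hval p).of_le (by norm_cast))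
  -- criticality in the chart `κ`
  rw [isMCriticalPt_iff_fderiv_comp_extend_symm_eq_zero_of_isInteriorPoint hFv hκ2 hpκ hint,
    (Φ.comp_val_comp_extend_symm_eventuallyEq F D hp hint).fderiv_eq,
    D.extend_chart_apply (p := p) (q := p) hp]
  -- the point `sliceInl (dropLast (Θ p)) = Θ p`
  have hpt : sliceInl (k + 1) (dropLast k (D.Θ p.1)) = D.Θ p.1 := by
    rw [sliceInl_apply, D.snocEquiv_dropLast_apply hp p.2]
  have hFΘ : ContDiffAt ℝ 2 (F ∘ D.Θ.symm) (D.Θ p.1) := by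
    have := contDiffAt_comp_extend_symm hF hΘ2 hp
    simpa [OpenPartialHomeomorph.extend_coe, OpenPartialHomeomorph.extend_coe_symm] using this
  have hdiff : DifferentiableAt ℝ (F ∘ D.Θ.symm) (sliceInl (k + 1) (dropLast k (D.Θ p.1))) := by
    rw [hpt]; exact hFΘ.differentiableAt (by norm_num)
  rw [fderiv_comp _ hdiff (sliceInl (k + 1)).differentiableAt, ContinuousLinearMap.fderiv, hpt]
  -- change to the chart `e`
  set T := fderiv ℝ ((𝓡 (k + 2)).extendCoordChange D.Θ e) (D.Θ p.1) with hT
  have hev := RegularLevel.comp_symm_eventuallyEq_comp_extendCoordChange F hp hpe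
  have hτ : ContDiffAt ℝ 2 ((𝓡 (k + 2)).extendCoordChange D.Θ e) (D.Θ p.1) :=
    RegularLevel.contDiffAt_extendCoordChange hΘ2 he2 hp hpe
  have hτp : (𝓡 (k + 2)).extendCoordChange D.Θ e (D.Θ p.1) = e p.1 := by
    simp [ModelWithCorners.extendCoordChange, D.Θ.left_inv hp]
  have hFe : ContDiffAt ℝ 2 (F ∘ e.symm) (e p.1) := by
    have := contDiffAt_comp_extend_symm hF he2 hpe
    simpa [OpenPartialHomeomorph.extend_coe, OpenPartialHomeomorph.extend_coe_symm] using this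
  have hchain : fderiv ℝ (F ∘ D.Θ.symm) (D.Θ p.1) = (fderiv ℝ (F ∘ e.symm) (e p.1)).comp T := by
    rw [hev.fderiv_eq, fderiv_comp _ (by rw [hτp]; exact hFe.differentiableAt (by norm_num))
      (hτ.differentiableAt (by norm_num)), hτp]
  have hV := range_fderiv_extendCoordChange_comp_sliceInl D hp he hpe
  rw [hchain, ContinuousLinearMap.comp_assoc]
  constructor
  · intro h0 v hv
    have hv' : v ∈ LinearMap.ker (fderiv ℝ ((fun q => D.Θ q (Fin.last (k + 1))) ∘ e.symm) (e p.1) :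
        EuclideanSpace ℝ (Fin (k + 2)) →ₗ[ℝ] ℝ) := hv
    rw [← hV] at hv'
    obtain ⟨u, rfl⟩ := hv'
    exact congrArg (fun L : EuclideanSpace ℝ (Fin (k + 1)) →L[ℝ] ℝ => L u) h0
  · intro hall
    ext u
    have hu : (T.comp (sliceInl (k + 1))) u ∈
        LinearMap.ker (fderiv ℝ ((fun q => D.Θ q (Fin.last (k + 1))) ∘ e.symm) (e p.1) :
          EuclideanSpace ℝ (Fin (k + 2)) →ₗ[ℝ] ℝ) := by
      rw [← hV]; exact ⟨u, rfl⟩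
    simpa using hall _ hu

/-- An ambient critical point of `F` at an interior point of `S` is a critical point of `F|S`. [folklore] -/
theorem isMCriticalPt_comp_val_of_isMCriticalPt {F : M → ℝ} (D : BoundarySliceChart k S) {p : S}
    (hp : p.1 ∈ D.Θ.source) (hint : letI := Φ.chartedSpace; (𝓡∂ (k + 1)).IsInteriorPoint p)
    (hF : ContMDiffAt (𝓡 (k + 2)) 𝓘(ℝ, ℝ) 2 F p.1) (hcrit : IsMCriticalPt (𝓡 (k + 2)) F p.1) :
    letI := Φ.chartedSpace
    IsMCriticalPt (𝓡∂ (k + 1)) (F ∘ Subtype.val) p := by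
  have hΘ2 : D.Θ ∈ IsManifold.maximalAtlas (𝓡 (k + 2)) 2 M :=
    IsManifold.maximalAtlas_subset_of_le (by norm_cast) D.Θ_mem_maximalAtlas
  have h0 : fderiv ℝ (F ∘ D.Θ.symm) (D.Θ p.1) = 0 := by
    have := (isMCriticalPt_iff_fderiv_comp_extend_symm_eq_zero hF hΘ2 hp).1 hcrit
    simpa [OpenPartialHomeomorph.extend_coe, OpenPartialHomeomorph.extend_coe_symm] using this
  rw [isMCriticalPt_comp_val_iff_of_chart D hp hint hF D.Θ_mem_maximalAtlas hp]
  intro v _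
  rw [h0]; rfl

/-! ### The Hessian of `F|S` at an ambient critical point -/

/-- **The Hessian of `F|S` at an ambient critical point, read in any chart**: if the interior
point `p` of `S` is a critical point of `F` on `M`, then for a boundary slice chart `D` and a
chart `e` of the maximal atlas at `p` there is a linear automorphism `L₀` of `ℝᵏ⁺¹` with
`Hess(F|S)_p(v, w) = D²(F ∘ e⁻¹)(e p)(T (L₀ v, 0), T (L₀ w, 0))`, `T` the derivative at `Θ p` of
`e ∘ Θ⁻¹` (second-order chain rule at a critical point: the first-order term vanishes).
[cite: Milnor1963, §2] -/
theorem exists_mhessian_comp_val_apply_of_chart {F : M → ℝ} (D : BoundarySliceChart k S) {p : S}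
    (hp : p.1 ∈ D.Θ.source) (hint : letI := Φ.chartedSpace; (𝓡∂ (k + 1)).IsInteriorPoint p)
    (hF : ContMDiffAt (𝓡 (k + 2)) 𝓘(ℝ, ℝ) 2 F p.1) (hcrit : IsMCriticalPt (𝓡 (k + 2)) F p.1)
    {e : OpenPartialHomeomorph M (EuclideanSpace ℝ (Fin (k + 2)))}
    (he : e ∈ IsManifold.maximalAtlas (𝓡 (k + 2)) ∞ M) (hpe : p.1 ∈ e.source) :
    letI := Φ.chartedSpace
    ∃ L₀ : EuclideanSpace ℝ (Fin (k + 1)) ≃L[ℝ] EuclideanSpace ℝ (Fin (k + 1)), ∀ v w,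
      mhessian (𝓡∂ (k + 1)) (F ∘ Subtype.val) p v w =
        fderiv ℝ (fderiv ℝ (F ∘ e.symm)) (e p.1)
          (fderiv ℝ ((𝓡 (k + 2)).extendCoordChange D.Θ e) (D.Θ p.1) (sliceInl (k + 1) (L₀ v)))
          (fderiv ℝ ((𝓡 (k + 2)).extendCoordChange D.Θ e) (D.Θ p.1) (sliceInl (k + 1) (L₀ w))) := by
  letI := Φ.chartedSpace
  haveI := Φ.isManifold
  set κ := D.chart p with hκ
  have hκ2 : κ ∈ IsManifold.maximalAtlas (𝓡∂ (k + 1)) 2 S :=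
    IsManifold.maximalAtlas_subset_of_le (by norm_cast) (Φ.chart_mem_maximalAtlas D p)
  have hκ1 : κ ∈ IsManifold.maximalAtlas (𝓡∂ (k + 1)) 1 S :=
    IsManifold.maximalAtlas_subset_of_le (by norm_cast) (Φ.chart_mem_maximalAtlas D p)
  have hΘ2 : D.Θ ∈ IsManifold.maximalAtlas (𝓡 (k + 2)) 2 M :=
    IsManifold.maximalAtlas_subset_of_le (by norm_cast) D.Θ_mem_maximalAtlas
  have he2 : e ∈ IsManifold.maximalAtlas (𝓡 (k + 2)) 2 M :=
    IsManifold.maximalAtlas_subset_of_le (by norm_cast) he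
  have hpκ : p ∈ κ.source := hp
  have hval : ContMDiff (𝓡∂ (k + 1)) (𝓡 (k + 2)) ∞ (Subtype.val : S → M) := Φ.contMDiff_subtype_val
  have hFv : ContMDiffAt (𝓡∂ (k + 1)) 𝓘(ℝ, ℝ) 2 (F ∘ Subtype.val) p :=
    hF.comp p ((hval p).of_le (by norm_cast))
  have hcritv : IsMCriticalPt (𝓡∂ (k + 1)) (F ∘ Subtype.val) p :=
    isMCriticalPt_comp_val_of_isMCriticalPt D hp hint hF hcrit
  -- from the preferred chart to `κ`
  obtain ⟨L₀, hL₀⟩ := isInvertible_fderiv_extendCoordChange_chartAt_of_isInteriorPoint hκ2 hpκ hint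
  refine ⟨L₀, fun v w => ?_⟩
  rw [mhessian_apply_eq_hessianInChart_of_isInteriorPoint hFv hcritv hκ2 hpκ hint, ← hL₀,
    hessianInChart_apply_eq_fderiv_fderiv_of_isInteriorPoint hκ1 hpκ hint]
  change fderiv ℝ (fderiv ℝ ((F ∘ Subtype.val) ∘ (κ.extend (𝓡∂ (k + 1))).symm))
      (κ.extend (𝓡∂ (k + 1)) p) (L₀ v) (L₀ w) = _
  rw [((Φ.comp_val_comp_extend_symm_eventuallyEq F D hp hint).fderiv).fderiv_eq,
    D.extend_chart_apply (p := p) (q := p) hp]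
  -- through the slice embedding
  have hpt : sliceInl (k + 1) (dropLast k (D.Θ p.1)) = D.Θ p.1 := by
    rw [sliceInl_apply, D.snocEquiv_dropLast_apply hp p.2]
  have hFΘ : ContDiffAt ℝ 2 (F ∘ D.Θ.symm) (D.Θ p.1) := by
    have := contDiffAt_comp_extend_symm hF hΘ2 hp
    simpa [OpenPartialHomeomorph.extend_coe, OpenPartialHomeomorph.extend_coe_symm] using this
  have hFΘ' : ContDiffAt ℝ 2 (F ∘ D.Θ.symm) (sliceInl (k + 1) (dropLast k (D.Θ p.1))) := by
    rw [hpt]; exact hFΘ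
  rw [fderiv_fderiv_comp_clm_apply (sliceInl (k + 1)) hFΘ' (L₀ v) (L₀ w), hpt]
  -- through the change of coordinates `e ∘ Θ⁻¹` at the ambient critical point
  have hev := RegularLevel.comp_symm_eventuallyEq_comp_extendCoordChange F hp hpe
  have hτ : ContDiffAt ℝ 2 ((𝓡 (k + 2)).extendCoordChange D.Θ e) (D.Θ p.1) :=
    RegularLevel.contDiffAt_extendCoordChange hΘ2 he2 hp hpe
  have hτp : (𝓡 (k + 2)).extendCoordChange D.Θ e (D.Θ p.1) = e p.1 := by
    simp [ModelWithCorners.extendCoordChange, D.Θ.left_inv hp]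
  have hFe : ContDiffAt ℝ 2 (F ∘ e.symm) ((𝓡 (k + 2)).extendCoordChange D.Θ e (D.Θ p.1)) := by
    rw [hτp]
    have := contDiffAt_comp_extend_symm hF he2 hpe
    simpa [OpenPartialHomeomorph.extend_coe, OpenPartialHomeomorph.extend_coe_symm] using this
  have hcrit' : fderiv ℝ (F ∘ e.symm) ((𝓡 (k + 2)).extendCoordChange D.Θ e (D.Θ p.1)) = 0 := by
    rw [hτp]
    have := (isMCriticalPt_iff_fderiv_comp_extend_symm_eq_zero hF he2 hpe).1 hcrit
    simpa [OpenPartialHomeomorph.extend_coe, OpenPartialHomeomorph.extend_coe_symm] using this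
  rw [(hev.fderiv).fderiv_eq, fderiv_fderiv_comp_apply_of_fderiv_eq_zero hFe hτ hcrit', hτp]

/-- **Morse data of `F|S` at an ambient critical point, through the tangent hyperplane.**  Let
the interior point `p` of `S` be a critical point of `F` on `M`, `D` a boundary slice chart and
`e` a chart of the maximal atlas at `p`, `B = D²(F ∘ e⁻¹)(e p)` (`hessianInChart`) and
`V = ker D(g ∘ e⁻¹)(e p)`, `g = Θ_{k+1}`.  Then there is a linear isomorphism `L : ℝᵏ⁺¹ ≃ V`
with `Hess(F|S)_p(v, w) = B(L v, L w)`: the Hessian of `F|S` is congruent to `B|_V`. [cite: Milnor1963, §2] -/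
theorem exists_linearEquiv_mhessian_comp_val_eq {F : M → ℝ} (D : BoundarySliceChart k S) {p : S}
    (hp : p.1 ∈ D.Θ.source) (hint : letI := Φ.chartedSpace; (𝓡∂ (k + 1)).IsInteriorPoint p)
    (hF : ContMDiffAt (𝓡 (k + 2)) 𝓘(ℝ, ℝ) 2 F p.1) (hcrit : IsMCriticalPt (𝓡 (k + 2)) F p.1)
    {e : OpenPartialHomeomorph M (EuclideanSpace ℝ (Fin (k + 2)))}
    (he : e ∈ IsManifold.maximalAtlas (𝓡 (k + 2)) ∞ M) (hpe : p.1 ∈ e.source) :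
    letI := Φ.chartedSpace
    ∃ L : EuclideanSpace ℝ (Fin (k + 1)) ≃ₗ[ℝ]
        LinearMap.ker (fderiv ℝ ((fun q => D.Θ q (Fin.last (k + 1))) ∘ e.symm) (e p.1) :
          EuclideanSpace ℝ (Fin (k + 2)) →ₗ[ℝ] ℝ),
      ∀ v w, mhessian (𝓡∂ (k + 1)) (F ∘ Subtype.val) p v w =
        (hessianInChart (𝓡 (k + 2)) e F p.1).restrict
          (LinearMap.ker (fderiv ℝ ((fun q => D.Θ q (Fin.last (k + 1))) ∘ e.symm) (e p.1) :
            EuclideanSpace ℝ (Fin (k + 2)) →ₗ[ℝ] ℝ)) (L v) (L w) := by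
  letI := Φ.chartedSpace
  obtain ⟨L₀, hL₀⟩ := exists_mhessian_comp_val_apply_of_chart D hp hint hF hcrit he hpe
  have hΘ2 : D.Θ ∈ IsManifold.maximalAtlas (𝓡 (k + 2)) 2 M :=
    IsManifold.maximalAtlas_subset_of_le (by norm_cast) D.Θ_mem_maximalAtlas
  have he2 : e ∈ IsManifold.maximalAtlas (𝓡 (k + 2)) 2 M :=
    IsManifold.maximalAtlas_subset_of_le (by norm_cast) he
  set T := fderiv ℝ ((𝓡 (k + 2)).extendCoordChange D.Θ e) (D.Θ p.1) with hT
  set V := LinearMap.ker (fderiv ℝ ((fun q => D.Θ q (Fin.last (k + 1))) ∘ e.symm) (e p.1) :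
    EuclideanSpace ℝ (Fin (k + 2)) →ₗ[ℝ] ℝ) with hV
  set A : EuclideanSpace ℝ (Fin (k + 1)) →ₗ[ℝ] EuclideanSpace ℝ (Fin (k + 2)) :=
    ((T.comp ((sliceInl (k + 1)).comp (L₀ : EuclideanSpace ℝ (Fin (k + 1)) →L[ℝ] EuclideanSpace ℝ (Fin (k + 1)))) :
      EuclideanSpace ℝ (Fin (k + 1)) →L[ℝ] EuclideanSpace ℝ (Fin (k + 2))) :
        EuclideanSpace ℝ (Fin (k + 1)) →ₗ[ℝ] EuclideanSpace ℝ (Fin (k + 2))) with hA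
  have hrange0 := range_fderiv_extendCoordChange_comp_sliceInl D hp he hpe
  have hrange : LinearMap.range A = V := by
    rw [hV, ← hrange0]
    apply le_antisymm
    · rintro _ ⟨u, rfl⟩; exact ⟨L₀ u, rfl⟩
    · rintro _ ⟨u, rfl⟩
      refine ⟨L₀.symm u, ?_⟩
      show T (sliceInl (k + 1) (L₀ (L₀.symm u))) = T (sliceInl (k + 1) u)
      rw [ContinuousLinearEquiv.apply_symm_apply]
  have hinjT : Injective T := (RegularLevel.isInvertible_fderiv_extendCoordChange hΘ2 he2 hp hpe).injective
  have hinj : Injective A :=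
    hinjT.comp ((sliceInl_injective (k + 1)).comp L₀.injective)
  set A' : EuclideanSpace ℝ (Fin (k + 1)) →ₗ[ℝ] V := A.codRestrict V (fun u => by rw [← hrange]; exact ⟨u, rfl⟩) with hA'
  have hinj' : Injective A' := by
    intro u u' huu
    apply hinj
    exact congrArg Subtype.val huu
  have hsurj' : Surjective A' := by
    rintro ⟨y, hy⟩
    rw [← hrange] at hy
    obtain ⟨u, rfl⟩ := hy
    exact ⟨u, rfl⟩
  refine ⟨LinearEquiv.ofBijective A' ⟨hinj', hsurj'⟩, fun v w => ?_⟩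
  rw [hL₀ v w]
  change _ = hessianInChart (𝓡 (k + 2)) e F p.1 (T (sliceInl (k + 1) (L₀ v))) (T (sliceInl (k + 1) (L₀ w)))
  rw [RegularLevel.hessianInChart_apply_eq]

/-- **Nondegeneracy of `F|S` at an ambient critical point** is that of `D²(F ∘ e⁻¹)(e p)`
restricted to `V = ker D(g ∘ e⁻¹)(e p)`. [cite: Milnor1963, §2] -/
theorem nondegenerate_mhessian_comp_val_iff {F : M → ℝ} (D : BoundarySliceChart k S) {p : S}
    (hp : p.1 ∈ D.Θ.source) (hint : letI := Φ.chartedSpace; (𝓡∂ (k + 1)).IsInteriorPoint p)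
    (hF : ContMDiffAt (𝓡 (k + 2)) 𝓘(ℝ, ℝ) 2 F p.1) (hcrit : IsMCriticalPt (𝓡 (k + 2)) F p.1)
    {e : OpenPartialHomeomorph M (EuclideanSpace ℝ (Fin (k + 2)))}
    (he : e ∈ IsManifold.maximalAtlas (𝓡 (k + 2)) ∞ M) (hpe : p.1 ∈ e.source) :
    letI := Φ.chartedSpace
    (mhessian (𝓡∂ (k + 1)) (F ∘ Subtype.val) p).Nondegenerate ↔
      ((hessianInChart (𝓡 (k + 2)) e F p.1).restrict
        (LinearMap.ker (fderiv ℝ ((fun q => D.Θ q (Fin.last (k + 1))) ∘ e.symm) (e p.1) :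
          EuclideanSpace ℝ (Fin (k + 2)) →ₗ[ℝ] ℝ))).Nondegenerate := by
  obtain ⟨L, hL⟩ := exists_linearEquiv_mhessian_comp_val_eq D hp hint hF hcrit he hpe
  exact nondegenerate_iff_of_forall_apply_eq L hL

/-- **The Morse index of `F|S` at an ambient critical point** is the negative index of inertia
of `D²(F ∘ e⁻¹)(e p)` restricted to `V = ker D(g ∘ e⁻¹)(e p)` (Sylvester; Milnor 1963, §2).
This is how the critical points of the Morse function of the handlebody `H₂₃` of the trisection
construction — restrictions of explicit functions on the `4`-manifold — are certified
nondegenerate of the right index. [cite: Milnor1963, §2] [cite: GayKirby2016, §4, Lemma 14] -/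
theorem morseIndex_comp_val_eq {F : M → ℝ} (D : BoundarySliceChart k S) {p : S}
    (hp : p.1 ∈ D.Θ.source) (hint : letI := Φ.chartedSpace; (𝓡∂ (k + 1)).IsInteriorPoint p)
    (hF : ContMDiffAt (𝓡 (k + 2)) 𝓘(ℝ, ℝ) 2 F p.1) (hcrit : IsMCriticalPt (𝓡 (k + 2)) F p.1)
    {e : OpenPartialHomeomorph M (EuclideanSpace ℝ (Fin (k + 2)))}
    (he : e ∈ IsManifold.maximalAtlas (𝓡 (k + 2)) ∞ M) (hpe : p.1 ∈ e.source) :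
    letI := Φ.chartedSpace
    morseIndex (𝓡∂ (k + 1)) (F ∘ Subtype.val) p =
      sigNeg ((hessianInChart (𝓡 (k + 2)) e F p.1).restrict
        (LinearMap.ker (fderiv ℝ ((fun q => D.Θ q (Fin.last (k + 1))) ∘ e.symm) (e p.1) :
          EuclideanSpace ℝ (Fin (k + 2)) →ₗ[ℝ] ℝ))).toQuadraticMap := by
  letI := Φ.chartedSpace
  obtain ⟨L, hL⟩ := exists_linearEquiv_mhessian_comp_val_eq D hp hint hF hcrit he hpe
  unfold morseIndex
  exact sigNeg_eq_of_forall_apply_eq L hL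

end BoundarySliceAtlas

end Literature.Topology.FourManifolds

end
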